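import Mathlib.Data.List.GetD
import Summits.Ventures.PackingBounds.Configurations.ListConfig

/-!
# Spherical codes from integer points: kernel-checkable pairwise inner-product bounds for arbitrary configurations

Framing: lottery ticket; floor = certified bounds/negative ranges. Venture `PackingBounds` (cell
`pub-packcert`, seat `pub-packcert-recog`) — attained-side infrastructure for configurations WITHOUT a
regular distance distribution (putative Tammes configurations, numerically found codes), complementing
`ListConfig.lean` (which checks a full distance-distribution table shared by every point).

A configuration is a list of pairs `(x, w)` with `x : List ℤ` of length `n`, `w : ℤ`, `w > 0` and
`x·x = w²` (an integer point on the sphere of radius `w`); the attached unit vector is `x / w ∈ ℝⁿ`.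
The Boolean programs `sphereOK` (lengths, `x·x = w²`, `w > 0`) and `pairsOK num den` (for all pairs at
distinct positions: `(x·x')·den ≤ num·(w w')`, i.e. `⟪x/w, x'/w'⟫ ≤ num/den`) are run by `decide`; the
theorems turn `= true` into: unit norms (`norm_eq_one`), pairwise inner products `≤ num/den` (`inner_le`)
and, when `num < den`, cardinality `= |L|` (`card_eq`), packaged as `exists_code`.
-/

namespace Summit.Ventures.PackingBounds.Config.IntCode

open Finset WithLp Summit.Ventures.PackingBounds.Config

/-- Sphere check: every entry `(x, w)` has `x.length = n`, `x·x = w²` and `w > 0`. -/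
def sphereOK (L : List (List ℤ × ℤ)) (n : ℕ) : Bool :=
  L.all fun p => p.1.length == n && dotL p.1 p.1 == p.2 * p.2 && decide (0 < p.2)

/-- Pair check: for all positions `i ≠ j`, `(x_i·x_j)·den ≤ num·(w_i w_j)`. -/
def pairsOK (L : List (List ℤ × ℤ)) (num : ℤ) (den : ℕ) : Bool :=
  (List.range L.length).all fun i => (List.range L.length).all fun j =>
    i == j || decide (dotL (L.getD i ([], 0)).1 (L.getD j ([], 0)).1 * (den : ℤ) ≤
      num * ((L.getD i ([], 0)).2 * (L.getD j ([], 0)).2))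

/-- The unit vector `x / w ∈ ℝⁿ` attached to an entry `(x, w)`. -/
noncomputable def pt (n : ℕ) (p : List ℤ × ℤ) : EuclideanSpace ℝ (Fin n) :=
  toLp 2 fun i => ((p.2 : ℝ))⁻¹ * ((p.1.getD i 0 : ℤ) : ℝ)

/-- The configuration attached to `L`: the set of the unit vectors of its entries. -/
noncomputable def code (n : ℕ) (L : List (List ℤ × ℤ)) : Finset (EuclideanSpace ℝ (Fin n)) :=
  (Finset.univ : Finset (Fin L.length)).image fun i => pt n (L.get i)

variable {n : ℕ} {L : List (List ℤ × ℤ)} {num : ℤ} {den : ℕ}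

/-- Inner product of two attached vectors: `⟪x/w, x'/w'⟫ = (x·x') / (w w')`. -/
theorem inner_pt (p p' : List ℤ × ℤ) (hp : p.1.length = n) (hp' : p'.1.length = n) :
    inner ℝ (pt n p) (pt n p') = ((dotL p.1 p'.1 : ℤ) : ℝ) / ((p.2 : ℝ) * (p'.2 : ℝ)) := by
  rw [pt, pt, EuclideanSpace.inner_toLp_toLp, dotProduct]
  simp only [star_trivial]
  have h := sum_getD_mul_getD (Int.castRingHom ℝ) n p.1 p'.1 hp hp'
  simp only [eq_intCast] at h
  calc ∑ i : Fin n, ((p'.2 : ℝ))⁻¹ * ((p'.1.getD i 0 : ℤ) : ℝ) * (((p.2 : ℝ))⁻¹ * ((p.1.getD i 0 : ℤ) : ℝ))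
      = ((p.2 : ℝ))⁻¹ * ((p'.2 : ℝ))⁻¹ * ∑ i : Fin n, ((p.1.getD i 0 : ℤ) : ℝ) * ((p'.1.getD i 0 : ℤ) : ℝ) := by
        rw [Finset.mul_sum]; exact Finset.sum_congr rfl fun i _ => by ring
    _ = ((dotL p.1 p'.1 : ℤ) : ℝ) / ((p.2 : ℝ) * (p'.2 : ℝ)) := by rw [h]; ring

/-- Consequences of the sphere check for a member. -/
theorem of_sphereOK (hS : sphereOK L n = true) {p : List ℤ × ℤ} (hp : p ∈ L) :
    p.1.length = n ∧ dotL p.1 p.1 = p.2 * p.2 ∧ 0 < p.2 := by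
  simp only [sphereOK, List.all_eq_true, Bool.and_eq_true, beq_iff_eq, decide_eq_true_eq] at hS
  exact ⟨(hS p hp).1.1, (hS p hp).1.2, (hS p hp).2⟩

/-- A member's attached vector is a unit vector. -/
theorem norm_pt (hS : sphereOK L n = true) {p : List ℤ × ℤ} (hp : p ∈ L) : ‖pt n p‖ = 1 := by
  obtain ⟨hl, hd, hw⟩ := of_sphereOK hS hp
  have h := inner_pt p p hl hl
  have hw' : (0 : ℝ) < p.2 := by exact_mod_cast hw
  rw [hd, real_inner_self_eq_norm_sq] at h
  push_cast at h
  rw [div_self (mul_pos hw' hw').ne'] at h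
  nlinarith [norm_nonneg (pt n p)]

/-- The pair check at two distinct positions. -/
theorem of_pairsOK (hP : pairsOK L num den = true) (i j : Fin L.length) (hij : i ≠ j) :
    dotL (L.get i).1 (L.get j).1 * (den : ℤ) ≤ num * ((L.get i).2 * (L.get j).2) := by
  simp only [pairsOK, List.all_eq_true, List.mem_range, Bool.or_eq_true, beq_iff_eq,
    decide_eq_true_eq] at hP
  have h := hP i.1 i.2 j.1 j.2
  rcases h with h | h
  · exact absurd (Fin.ext h) hij
  · rwa [List.getD_eq_getElem _ _ i.2, List.getD_eq_getElem _ _ j.2, ← List.get_eq_getElem,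
      ← List.get_eq_getElem] at h

/-- Inner products of attached vectors at distinct positions are `≤ num/den`. -/
theorem inner_pt_le (hS : sphereOK L n = true) (hP : pairsOK L num den = true) (hden : 0 < den)
    (i j : Fin L.length) (hij : i ≠ j) :
    inner ℝ (pt n (L.get i)) (pt n (L.get j)) ≤ (num : ℝ) / den := by
  obtain ⟨hli, _, hwi⟩ := of_sphereOK hS (List.get_mem L i)
  obtain ⟨hlj, _, hwj⟩ := of_sphereOK hS (List.get_mem L j)
  have hwi' : (0 : ℝ) < (L.get i).2 := by exact_mod_cast hwi
  have hwj' : (0 : ℝ) < (L.get j).2 := by exact_mod_cast hwj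
  have hd : (0 : ℝ) < den := by exact_mod_cast hden
  have h := of_pairsOK hP i j hij
  have h' : ((dotL (L.get i).1 (L.get j).1 : ℤ) : ℝ) * (den : ℝ) ≤
      (num : ℝ) * (((L.get i).2 : ℝ) * ((L.get j).2 : ℝ)) := by exact_mod_cast h
  rw [inner_pt _ _ hli hlj, div_le_div_iff₀ (mul_pos hwi' hwj') hd]
  linarith

/-- Every point of the configuration is a unit vector. -/
theorem norm_eq_one (hS : sphereOK L n = true) : ∀ x ∈ code n L, ‖x‖ = 1 := by
  intro x hx
  obtain ⟨i, _, rfl⟩ := Finset.mem_image.1 hx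
  exact norm_pt hS (List.get_mem L i)

/-- Pairwise inner products of the configuration are `≤ num/den`. -/
theorem inner_le (hS : sphereOK L n = true) (hP : pairsOK L num den = true) (hden : 0 < den) :
    ∀ x ∈ code n L, ∀ y ∈ code n L, x ≠ y → inner ℝ x y ≤ (num : ℝ) / den := by
  intro x hx y hy hxy
  obtain ⟨i, _, rfl⟩ := Finset.mem_image.1 hx
  obtain ⟨j, _, rfl⟩ := Finset.mem_image.1 hy
  have hij : i ≠ j := fun h => hxy (by rw [h])
  exact inner_pt_le hS hP hden i j hij

/-- With `num < den` the attached vectors are pairwise distinct, so the configuration has `|L|` points. -/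
theorem card_eq (hS : sphereOK L n = true) (hP : pairsOK L num den = true) (hden : 0 < den)
    (hlt : num < den) : (code n L).card = L.length := by
  rw [code, Finset.card_image_of_injective _ fun i j hij => ?_, Finset.card_univ, Fintype.card_fin]
  by_contra hne
  have h := inner_pt_le hS hP hden i j hne
  rw [hij, real_inner_self_eq_norm_sq, norm_pt hS (List.get_mem L j), one_pow] at h
  have hd : (0 : ℝ) < den := by exact_mod_cast hden
  have : (num : ℝ) < den := by exact_mod_cast hlt
  rw [le_div_iff₀ hd] at h
  linarith

/-- **Packaging.** A list passing `sphereOK` and `pairsOK num den` with `0 < den`, `num < den` gives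
`|L|` unit vectors of `ℝⁿ` with pairwise inner products `≤ num/den`. -/
theorem exists_code (hS : sphereOK L n = true) (hP : pairsOK L num den = true) (hden : 0 < den)
    (hlt : num < den) : ∃ C : Finset (EuclideanSpace ℝ (Fin n)), C.card = L.length ∧
      (∀ x ∈ C, ‖x‖ = 1) ∧ ∀ x ∈ C, ∀ y ∈ C, x ≠ y → inner ℝ x y ≤ (num : ℝ) / den :=
  ⟨code n L, card_eq hS hP hden hlt, norm_eq_one hS, inner_le hS hP hden⟩

end Summit.Ventures.PackingBounds.Config.IntCode
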